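import Summits.QuantumFields.YangMills.Theorems.BalabanUVNodesN15CurvedCubeTransplant
import Literature.MathematicalPhysics.QuantumFieldTheory.King1986.MinimizerTowerBridge
import HarnessLib

/-!
# Route «BalabanUVNodes» (cluster K4 «SpineRates»), Track-A DAG node N15 = NE2 — KING-TORUS BOX WINDOWS AND CHARTS AT TWO SPACINGS: the geometric inhabitant of the seven transplant hypotheses of `…N15CurvedCubeTransplant` (windows `W`, `W_f = π⁻¹W`, charts BIJECTIVE onto the cube tori, `e(πy) = π′(e_f y)`, cube blocks = global blocks on the windows)

Cell `pub-ymgap`, width seat `pub-ymgap-dag-n15-w5` (director-ym R399 (3a) ∕ №207 second wave; node N15; dag-n15-w3's located successor trigger (t7) «the GEOMETRIC inhabitant of file 11's transplant hypotheses on King's torus», HOME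
`pub-ymgap-dag-n15-w3/HANDOFF.md`; dag-n15-a g19 «multi-cube embedding … NOT typed (R-α)», pub-ymgap INBOX l.28712). `bears_on: R4∕N15 · K3⁷ SpineGivenEndpointR13SepCoPH (stmt-QuantumFields-20544)`, filed `--supports stmt-QuantumFields-20544
--as helper` — COUNT-NEUTRAL.  Imports BY NAME dag-n15-w3 g2's file 11 `…N15CurvedCubeTransplant` (`windowInd`, `hasMaj_transplant`, `hasMaj_idef_transplant`, `hasMaj_idef_transplant_pair_proj`, `hasMaj_transplant_pair_proj`; through it
lit `B6Prop26ReachTransplant` (`restrictOp`, `extendOp`, `transplant`), `B11SectG` (`HasMaj`, `BlockNorm.ofBlocks`), `T4EtaRateDefect.idef`, `T4EtaRateCoeffDefect.pull`, the lineage's `MatrixSpecies.liftMap ∕ liftBlk`,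
`BackgroundLayer.projO ∕ blkPair ∕ liftPair`), lit King `TorusBlockForm` ∕ `UniformDecay` ∕ `MinimizerTowerBridge` (`site`, `corner`, `blockOf`, `val_site`, `site_eq`, `corner_eq_up`, `blockOf_site`, `exists_eq_site`), lit
`B5Prop11Plancherel` (`Tor`, `fine`), `B5Block118` (`up`); nothing in the tree is modified.

WHY.  [Balaban1984PropagatorsII] p. 238: *«We take the cube □̃³ and identify it with a torus, denoted by T_□»*; (2.133) p. 247 reads a cube-local kernel on the GLOBAL lattice.  File 11 types this identification ABSTRACTLY: a window `W ⊂
Y`, a chart `e : Y → X_□` injective on `W` (and, at the fine spacing, surjective onto the fine cube carrier), compatible windows `W_f = π⁻¹W` and charts `e(πy) = π′(e_f y)`, and cube blocks that ARE the global blocks on the windows —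
seven DISPLAYED hypotheses (`hinj`, `hinjf`, `hsurjf`, `hW`, `hcompat`, `hblk`, `hblkf`).  THIS FILE inhabits all seven on King's tori at two spacings: global tori `Tor M_g` (unit lattice) and `Tor (fine L M_g)` (η-lattice, block map
`blockOf L M_g`), a BOX of side `B ≤ M_g` (coordinatewise) with corner `x₀`, the cube tori `Tor B` and `Tor (fine L B)`: the window `boxWindow M_g B x₀ = {x : (x − x₀)_μ < B_μ ∀μ}` (offsets read by `ZMod.val`), the chart `boxChart M_g B
x₀ x = (x − x₀) mod B` and its inverse `boxEmbed M_g B x₀ t = x₀ + t`; at the fine spacing the SAME objects at `(fine L M_g, fine L B, corner L M_g x₀)`.  ONE construction serves both readings of the cube torus: [B6]'s `T_□ = □̃³` (box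
side `3S`) and dag-n15-a's doubled Neumann cube `Tor (fine n M), M = 2S` (box side `2S`; the physical cube is a sub-box of the window; which OPERATOR is transplanted, and its locality defect on the big torus, is the consumers' business — dag-n15-a ∕ -w2 ∕ -w3).

* §1 `boxWindow`, `boxChart`, `boxEmbed`; `mem_boxWindow_iff`, `val_boxEmbed_sub`, `boxEmbed_mem`, `boxChart_boxEmbed`, `boxEmbed_boxChart`, ★ `injOn_boxChart` (= `hinj`), ★ `surj_boxChart` (= `hsurjf`; needs `B ≤ M_g`), `blk_boxChart` (=
  `hblk` for the cube blocks `blkY ∘ boxEmbed`); §1b `natCast_val_add_one`, ★ `boxChart_add_unitVec` ∕ ★ `boxChart_sub_unitVec` (the chart intertwines the unit translations that stay in the window = dag-n15-w2 g3's `hcompat` of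
  `…N15CurvedCubeTransplantGradient` for `E = τ_μ^{±1}`);
* §2 two spacings: `corner_sub`, `sub_corner_eq_site`, `val_sub_corner`, ★ `mem_boxWindow_fine_iff` (= `hW`: `y ∈ W_f ↔ blockOf y ∈ W`), ★★ `boxChart_fine_eq_site`, ★★ `boxChart_blockOf` (= `hcompat`: `boxChart (blockOf y) = blockOf
  (boxChart_f y)` on `W_f`), `blk_boxChart_fine` (= `hblkf`), `fine_le_fine`;
* §3 on the carriers with a vector index `ι` (`Tor M_g × ι`, windows `W ×ˢ univ`, charts `liftMap (boxChart …) ι`): `windowInd_product_univ`, the seven hypotheses in product form (`injOn_liftMap_boxChart`, `surj_liftMap_boxChart`,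
  `mem_product_fine_iff`, `liftMap_boxChart_blockOf`, `liftBlk_boxChart`, `liftBlk_boxChart_fine`) + the translation compatibilities `liftMap_boxChart_shift_compat` ∕ `liftMap_boxChart_shift_symm_compat` (dag-n15-w2's `hcompat` shape
  verbatim, any packaging of `τ_μ^{±1}`), and ★★ `hasMaj_transplant_box` ∕ ★★ `hasMaj_idef_transplant_box` (scalar carriers) ∕ ★★★ `hasMaj_idef_transplant_pair_proj_box` ∕ ★★ `hasMaj_transplant_pair_proj_box` — file 11's theorems with ALL
  SEVEN geometric hypotheses DISCHARGED: what stays displayed is the cube engine's own `key` (resp. `key₀`) and `K ≥ 0`.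

HONEST FRAMING ∕ LIMITS.  Finite-torus index arithmetic (an A6-type inhabitant of file 11's displayed GEOMETRY, [B6] p. 238 «□̃³ ⊂ T_η ↔ T_□» as SHAPE); the cube engine (`key`: majorants ∕ η-defects of the dressed pair on the cube tori,
with ITS hypotheses — inductive datum, carrier, smallness, letters) stays displayed exactly as in files 7∕10∕11; the partition of unity and the gluing are dag-n15-c's; the reflection structure of dag-n15-a's Neumann cube is not touched;
nothing of [B5]∕[B6]∕[B9] asserted.  NE2⁺ NOT PRINTED, NOT proved; N15 NOT discharged; counts of record UNMOVED (typed 28∕28 · discharged 5∕27); one finite 𝕋⁴ at fixed ε — NOT infinite volume, NOT OS on ℝ⁴, NOT a mass gap, NOT Clay; R4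
closes the conditional finite-𝕋⁴ rung `BalabanLadder.UV` only.  No summit statement is proved by this file.  Restate-immune (no Theses import).
-/

set_option autoImplicit false

noncomputable section
open scoped BigOperators

namespace Summit.QuantumFields.YangMills.BalabanUVNodes.N15.TorusBoxCharts

open Literature.MathematicalPhysics.QuantumFieldTheory.Balaban1983to89
open Literature.MathematicalPhysics.QuantumFieldTheory.Balaban1983to89.B5Prop11Plancherel (Tor fine unitVec)
open Literature.MathematicalPhysics.QuantumFieldTheory.King1986.Torus (site corner blockOf val_site site_eq corner_eq_up blockOf_site exists_eq_site)
open Literature.MathematicalPhysics.QuantumFieldTheory.Balaban1983to89.B11SectG (BlockNorm HasMaj)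
open Literature.MathematicalPhysics.QuantumFieldTheory.Balaban1983to89.B6Prop26ReachTransplant (transplant)
open Literature.MathematicalPhysics.QuantumFieldTheory.Balaban1983to89.T4EtaRateDefect (idef)
open Literature.MathematicalPhysics.QuantumFieldTheory.Balaban1983to89.T4EtaRateCoeffDefect (pull)
open Summit.QuantumFields.YangMills.BalabanUVNodes.N15.MatrixSpecies (liftMap liftBlk)
open Summit.QuantumFields.YangMills.BalabanUVNodes.N15.CurvedSpecies (windowInd windowInd_of_mem windowInd_of_not hasMaj_transplant hasMaj_idef_transplant
  hasMaj_idef_transplant_pair_proj hasMaj_transplant_pair_proj)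

/-! ## §1 The box window, its chart onto the cube torus, and the inverse chart -/

section Box

variable {d : ℕ} (Mg B : Fin d → ℕ) [hMg : ∀ μ, NeZero (Mg μ)] [hB : ∀ μ, NeZero (B μ)] (x₀ : Tor Mg)

/-- THE BOX WINDOW of side `B` at the corner `x₀` in the torus `Tor M_g`: the sites `x` whose offset from the corner, read by `ZMod.val` coordinatewise, is `< B_μ` — the «□̃³ ⊂ T_η»
of [B6] p. 238 (any box side; the physical cube, its triple `□̃³`, or the doubled cube are instances). [cite: Balaban1984PropagatorsII, p.238 («We take the cube □̃³ and identify it with a torus»: shape)] -/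
def boxWindow : Finset (Tor Mg) := Finset.univ.filter fun x => ∀ μ, (x μ - x₀ μ).val < B μ

/-- THE BOX CHART onto the cube torus `Tor B`: the offset from the corner read `mod B` («identify it with a torus, denoted by T_□»). [cite: Balaban1984PropagatorsII, p.238 (T_□: shape)] -/
def boxChart (x : Tor Mg) : Tor B := fun μ => (((x μ - x₀ μ).val : ℕ) : ZMod (B μ))

/-- THE INVERSE CHART: the cube-torus site `t` placed at `x₀ + t` in the big torus. [cite: Balaban1984PropagatorsII, p.238 (T_□: shape)] -/
def boxEmbed (t : Tor B) : Tor Mg := fun μ => x₀ μ + (((t μ).val : ℕ) : ZMod (Mg μ))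

omit hB in
/-- Membership in the box window, unfolded. [folklore] -/
theorem mem_boxWindow_iff (x : Tor Mg) : x ∈ boxWindow Mg B x₀ ↔ ∀ μ, (x μ - x₀ μ).val < B μ := by
  simp only [boxWindow, Finset.mem_filter, Finset.mem_univ, true_and]

omit hMg in
/-- The offset of an embedded cube site from the corner is the cube coordinate (no wrap-around when `B ≤ M_g`). [folklore] -/
theorem val_boxEmbed_sub (hBM : ∀ μ, B μ ≤ Mg μ) (t : Tor B) (μ : Fin d) : (boxEmbed Mg B x₀ t μ - x₀ μ).val = (t μ).val := by
  simp only [boxEmbed, add_sub_cancel_left]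
  rw [ZMod.val_natCast, Nat.mod_eq_of_lt ((ZMod.val_lt _).trans_le (hBM μ))]

/-- Embedded cube sites lie in the window. [folklore] -/
theorem boxEmbed_mem (hBM : ∀ μ, B μ ≤ Mg μ) (t : Tor B) : boxEmbed Mg B x₀ t ∈ boxWindow Mg B x₀ := by
  rw [mem_boxWindow_iff]
  intro μ
  rw [val_boxEmbed_sub Mg B x₀ hBM]
  exact ZMod.val_lt _

omit hMg in
/-- `boxChart ∘ boxEmbed = id` (when `B ≤ M_g`). [folklore] -/
theorem boxChart_boxEmbed (hBM : ∀ μ, B μ ≤ Mg μ) (t : Tor B) : boxChart Mg B x₀ (boxEmbed Mg B x₀ t) = t := by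
  funext μ
  simp only [boxChart]
  rw [val_boxEmbed_sub Mg B x₀ hBM, ZMod.natCast_zmod_val]

omit hB in
/-- `boxEmbed ∘ boxChart = id` ON THE WINDOW. [folklore] -/
theorem boxEmbed_boxChart {x : Tor Mg} (hx : x ∈ boxWindow Mg B x₀) : boxEmbed Mg B x₀ (boxChart Mg B x₀ x) = x := by
  rw [mem_boxWindow_iff] at hx
  funext μ
  simp only [boxEmbed, boxChart]
  rw [ZMod.val_natCast, Nat.mod_eq_of_lt (hx μ), ZMod.natCast_zmod_val, add_sub_cancel]

omit hB in
/-- ★ THE CHART IS INJECTIVE ON THE WINDOW (= file 11's `hinj` ∕ `hinjf`). [cite: Balaban1984PropagatorsII, p.238 (identification □̃³ ↔ T_□: shape)] -/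
theorem injOn_boxChart : Set.InjOn (boxChart Mg B x₀) ↑(boxWindow Mg B x₀) := by
  intro x hx x' hx' h
  have h2 := congrArg (boxEmbed Mg B x₀) h
  rwa [boxEmbed_boxChart Mg B x₀ (Finset.mem_coe.1 hx), boxEmbed_boxChart Mg B x₀ (Finset.mem_coe.1 hx')] at h2

/-- ★ THE CHART MAPS THE WINDOW ONTO THE CUBE TORUS (= file 11's `hsurjf`), when the box fits: `B ≤ M_g` coordinatewise. [cite: Balaban1984PropagatorsII, p.238 (identification □̃³ ↔ T_□: shape)] -/
theorem surj_boxChart (hBM : ∀ μ, B μ ≤ Mg μ) (t : Tor B) : ∃ x ∈ boxWindow Mg B x₀, boxChart Mg B x₀ x = t :=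
  ⟨boxEmbed Mg B x₀ t, boxEmbed_mem Mg B x₀ hBM t, boxChart_boxEmbed Mg B x₀ hBM t⟩

omit hB in
/-- The cube blocks READ THROUGH THE CHART are the global blocks on the window (= file 11's `hblk` for `blk := blkY ∘ boxEmbed`). [folklore] -/
theorem blk_boxChart {S : Type} (blkY : Tor Mg → S) {x : Tor Mg} (hx : x ∈ boxWindow Mg B x₀) : (blkY ∘ boxEmbed Mg B x₀) (boxChart Mg B x₀ x) = blkY x := by
  simp only [Function.comp_apply]
  rw [boxEmbed_boxChart Mg B x₀ hx]

/-! ### §1b The chart intertwines the unit translations that stay inside the window (dag-n15-w2 g3's `hcompat` of `…N15CurvedCubeTransplantGradient`) -/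

omit hMg hB x₀ in
/-- Index arithmetic: reading `a ↦ a.val mod n` from `ℤ/m` to `ℤ/n` (`n ≤ m`) commutes with `+1` as long as both `a` and `a + 1` have label `< n` (the one wrap-around case forces `n = m`). [folklore] -/
theorem natCast_val_add_one {m n : ℕ} [NeZero m] [NeZero n] (hnm : n ≤ m) (a : ZMod m) (ha : a.val < n) (ha1 : (a + 1).val < n) :
    (((a + 1).val : ℕ) : ZMod n) = ((a.val : ℕ) : ZMod n) + 1 := by
  rcases Nat.lt_or_ge 1 m with hm | hm
  · haveI : Fact (1 < m) := ⟨hm⟩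
    rcases Nat.lt_or_ge (a.val + 1) m with h | h
    · rw [ZMod.val_add_of_lt (by rwa [ZMod.val_one]), ZMod.val_one, Nat.cast_succ]
    · have hav : a.val + 1 = m := le_antisymm (ZMod.val_lt a) h
      have hnm' : n = m := by omega
      subst hnm'
      have hcast : ((a.val : ℕ) : ZMod n) + 1 = 0 := by
        have h2 : ((a.val : ℕ) : ZMod n) + 1 = ((a.val + 1 : ℕ) : ZMod n) := by push_cast; rfl
        rw [h2, hav, ZMod.natCast_self]
      have ha0 : a + 1 = 0 := by rw [← ZMod.natCast_zmod_val a]; exact hcast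
      rw [ha0, ZMod.val_zero, Nat.cast_zero, hcast]
  · have hn1 : n = 1 := by have := NeZero.ne n; omega
    haveI : Subsingleton (ZMod n) := (ZMod.subsingleton_iff).2 hn1
    exact Subsingleton.elim _ _

/-- ★ THE CHART INTERTWINES A FORWARD UNIT TRANSLATION THAT STAYS IN THE WINDOW: `boxChart (x + e_μ) = boxChart x + e_μ` for `x, x + e_μ ∈ W` — dag-n15-w2 g3's displayed `hcompat`
(`e (E x) = E′ (e x)` on `W ∩ E⁻¹W`) for `E = τ_μ` on the big torus, `E′ = τ_μ` on the cube torus. [cite: Balaban1984PropagatorsII, p.238 (identification □̃³ ↔ T_□: shape)] -/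
theorem boxChart_add_unitVec (hBM : ∀ μ, B μ ≤ Mg μ) (μ : Fin d) {x : Tor Mg} (hx : x ∈ boxWindow Mg B x₀) (hx' : x + unitVec Mg μ ∈ boxWindow Mg B x₀) :
    boxChart Mg B x₀ (x + unitVec Mg μ) = boxChart Mg B x₀ x + unitVec B μ := by
  rw [mem_boxWindow_iff] at hx hx'
  funext ν
  simp only [boxChart, unitVec, Pi.add_apply]
  by_cases hν : ν = μ
  · subst hν
    have h1 := hx' ν
    simp only [Pi.add_apply, unitVec, Pi.single_eq_same, add_sub_right_comm] at h1
    rw [Pi.single_eq_same, Pi.single_eq_same, add_sub_right_comm]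
    exact natCast_val_add_one (hBM ν) (x ν - x₀ ν) (hx ν) h1
  · rw [Pi.single_eq_of_ne hν, Pi.single_eq_of_ne hν, add_zero, add_zero]

/-- ★ THE CHART INTERTWINES A BACKWARD UNIT TRANSLATION THAT STAYS IN THE WINDOW: `boxChart (x − e_μ) = boxChart x − e_μ` for `x, x − e_μ ∈ W`. [cite: Balaban1984PropagatorsII, p.238 (identification □̃³ ↔ T_□: shape)] -/
theorem boxChart_sub_unitVec (hBM : ∀ μ, B μ ≤ Mg μ) (μ : Fin d) {x : Tor Mg} (hx : x ∈ boxWindow Mg B x₀) (hx' : x - unitVec Mg μ ∈ boxWindow Mg B x₀) :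
    boxChart Mg B x₀ (x - unitVec Mg μ) = boxChart Mg B x₀ x - unitVec B μ := by
  have h := boxChart_add_unitVec Mg B x₀ hBM μ hx' (by rwa [sub_add_cancel])
  rw [sub_add_cancel] at h
  rw [h, add_sub_cancel_right]

end Box

/-! ## §2 Two spacings: the fine window is the block pre-image of the coarse one, and the charts commute with the block maps -/

section TwoSpacings

variable {d : ℕ} (L : ℕ) [NeZero L] (Mg B : Fin d → ℕ) [hMg : ∀ μ, NeZero (Mg μ)] [hB : ∀ μ, NeZero (B μ)] (x₀ : Tor Mg)

omit [NeZero L] in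
/-- `corner` is additive: `corner (b − b′) = corner b − corner b′` (`corner = B5Block118.up`, a coordinatewise group homomorphism). [folklore] -/
theorem corner_sub (b b' : Tor Mg) : corner L Mg (b - b') = corner L Mg b - corner L Mg b' := by
  rw [corner_eq_up, corner_eq_up, corner_eq_up]
  funext ν
  simp only [B5Block118.up, Pi.sub_apply, map_sub]

/-- The offset of a fine site from the fine corner `L·x₀` is the site with the SAME in-block offset over the coarse offset: `y − corner x₀ = site (blockOf y − x₀) j` for `y = site (blockOf y) j`. [folklore] -/
theorem sub_corner_eq_site (y : Tor (fine L Mg)) (j : Fin d → Fin L) (hy : y = site L Mg (blockOf L Mg y) j) :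
    y - corner L Mg x₀ = site L Mg (blockOf L Mg y - x₀) j := by
  conv_lhs => rw [hy]
  rw [site_eq, site_eq, corner_sub]
  abel

/-- Its label: `val (y − corner x₀)_μ = L · val (blockOf y − x₀)_μ + j_μ`. [folklore] -/
theorem val_sub_corner (y : Tor (fine L Mg)) (j : Fin d → Fin L) (hy : y = site L Mg (blockOf L Mg y) j) (μ : Fin d) :
    (y μ - corner L Mg x₀ μ).val = L * (blockOf L Mg y μ - x₀ μ).val + (j μ : ℕ) := by
  have h := congrArg (fun z : Tor (fine L Mg) => (z μ).val) (sub_corner_eq_site L Mg x₀ y j hy)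
  simp only [Pi.sub_apply, val_site] at h
  exact h

omit hB in
/-- ★ COMPATIBLE WINDOWS (= file 11's `hW`): a fine site lies in the fine box window (side `L·B`, corner `L·x₀`) iff its block lies in the coarse box window. [cite: Balaban1984PropagatorsII, p.238 (□̃³ at two spacings: shape)] -/
theorem mem_boxWindow_fine_iff (y : Tor (fine L Mg)) :
    y ∈ boxWindow (fine L Mg) (fine L B) (corner L Mg x₀) ↔ blockOf L Mg y ∈ boxWindow Mg B x₀ := by
  obtain ⟨j, hj⟩ := exists_eq_site L Mg y
  rw [mem_boxWindow_iff, mem_boxWindow_iff]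
  have hL : 0 < L := Nat.pos_of_ne_zero (NeZero.ne L)
  refine ⟨fun h μ => ?_, fun h μ => ?_⟩
  · have h1 := h μ
    rw [val_sub_corner L Mg x₀ y j hj μ] at h1
    exact Nat.lt_of_mul_lt_mul_left (lt_of_le_of_lt (Nat.le_add_right _ _) h1)
  · rw [val_sub_corner L Mg x₀ y j hj μ]
    have h1 : (blockOf L Mg y μ - x₀ μ).val + 1 ≤ B μ := h μ
    have hjL : (j μ : ℕ) < L := (j μ).isLt
    calc L * (blockOf L Mg y μ - x₀ μ).val + (j μ : ℕ) < L * (blockOf L Mg y μ - x₀ μ).val + L := by omega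
      _ = L * ((blockOf L Mg y μ - x₀ μ).val + 1) := by ring
      _ ≤ L * B μ := Nat.mul_le_mul_left _ h1

omit hB in
/-- ★★ THE FINE CHART IN BLOCK FORM: on the fine window, `boxChart_f y = site (boxChart (blockOf y)) j` for `y = site (blockOf y) j` — the fine chart preserves the in-block offset. [folklore] -/
theorem boxChart_fine_eq_site {y : Tor (fine L Mg)} (hy : y ∈ boxWindow (fine L Mg) (fine L B) (corner L Mg x₀)) (j : Fin d → Fin L)
    (hj : y = site L Mg (blockOf L Mg y) j) :
    boxChart (fine L Mg) (fine L B) (corner L Mg x₀) y = site L B (boxChart Mg B x₀ (blockOf L Mg y)) j := by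
  have hW := (mem_boxWindow_fine_iff L Mg B x₀ y).1 hy
  rw [mem_boxWindow_iff] at hW
  funext μ
  simp only [boxChart, site]
  rw [val_sub_corner L Mg x₀ y j hj μ, ZMod.val_natCast, Nat.mod_eq_of_lt (hW μ)]

/-- ★★ COMPATIBLE CHARTS (= file 11's `hcompat`): on the fine window, `boxChart (blockOf y) = blockOf (boxChart_f y)` — charting then blocking equals blocking then charting.
[cite: Balaban1984PropagatorsII, p.238 (□̃³ ↔ T_□ at two spacings: shape)] -/
theorem boxChart_blockOf {y : Tor (fine L Mg)} (hy : y ∈ boxWindow (fine L Mg) (fine L B) (corner L Mg x₀)) :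
    boxChart Mg B x₀ (blockOf L Mg y) = blockOf L B (boxChart (fine L Mg) (fine L B) (corner L Mg x₀) y) := by
  obtain ⟨j, hj⟩ := exists_eq_site L Mg y
  rw [boxChart_fine_eq_site L Mg B x₀ hy j hj, blockOf_site]

/-- The cube blocks read through the FINE chart and the cube block map are the global fine blocks (= file 11's `hblkf` for `blk := blkY ∘ boxEmbed`). [folklore] -/
theorem blk_boxChart_fine {S : Type} (blkY : Tor Mg → S) {y : Tor (fine L Mg)} (hy : y ∈ boxWindow (fine L Mg) (fine L B) (corner L Mg x₀)) :
    ((blkY ∘ boxEmbed Mg B x₀) ∘ blockOf L B) (boxChart (fine L Mg) (fine L B) (corner L Mg x₀) y) = blkY (blockOf L Mg y) := by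
  simp only [Function.comp_apply]
  rw [← boxChart_blockOf L Mg B x₀ hy, boxEmbed_boxChart Mg B x₀ ((mem_boxWindow_fine_iff L Mg B x₀ y).1 hy)]

omit [NeZero L] hMg hB in
/-- The fine box fits when the coarse one does: `L·B ≤ L·M_g`. [folklore] -/
theorem fine_le_fine (hBM : ∀ μ, B μ ≤ Mg μ) (μ : Fin d) : fine L B μ ≤ fine L Mg μ := Nat.mul_le_mul_left _ (hBM μ)

end TwoSpacings

/-! ## §3 The carriers with a vector index, the seven hypotheses in product form, and file 11's transplant theorems with the geometry discharged -/

section Product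

variable {d : ℕ} (Mg B : Fin d → ℕ) [hMg : ∀ μ, NeZero (Mg μ)] [hB : ∀ μ, NeZero (B μ)] (x₀ : Tor Mg) (ι : Type) [Fintype ι]

omit hMg hB [Fintype ι] in
/-- The window indicator of a product window `W ×ˢ univ` for blocks read on the first factor is the window indicator of `W`. [folklore] -/
theorem windowInd_product_univ {g : B6.Geometry} {X : Type} [Fintype ι] [Nonempty ι] (W : Finset X) (blk : X → g.Site) (y : g.Site) :
    windowInd (W ×ˢ (Finset.univ : Finset ι)) (liftBlk blk ι) y = windowInd W blk y := by
  by_cases h : ∃ x ∈ W, blk x = y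
  · obtain ⟨x, hx, hxy⟩ := h
    obtain ⟨i⟩ := ‹Nonempty ι›
    rw [windowInd_of_mem hx hxy, windowInd_of_mem (W := W ×ˢ (Finset.univ : Finset ι)) (x := (x, i)) (Finset.mk_mem_product hx (Finset.mem_univ i)) hxy]
  · rw [windowInd_of_not h, windowInd_of_not]
    rintro ⟨p, hp, hpy⟩
    exact h ⟨p.1, (Finset.mem_product.1 hp).1, hpy⟩

omit hB in
/-- `hinj` in product form. [folklore] -/
theorem injOn_liftMap_boxChart : Set.InjOn (liftMap (boxChart Mg B x₀) ι) ↑(boxWindow Mg B x₀ ×ˢ (Finset.univ : Finset ι)) := by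
  rintro ⟨x, i⟩ hx ⟨x', i'⟩ hx' h
  simp only [liftMap, Prod.mk.injEq] at h
  have hxW : x ∈ boxWindow Mg B x₀ := (Finset.mem_product.1 (Finset.mem_coe.1 hx)).1
  have hxW' : x' ∈ boxWindow Mg B x₀ := (Finset.mem_product.1 (Finset.mem_coe.1 hx')).1
  rw [injOn_boxChart Mg B x₀ (Finset.mem_coe.2 hxW) (Finset.mem_coe.2 hxW') h.1, h.2]

/-- `hsurjf` in product form. [folklore] -/
theorem surj_liftMap_boxChart (hBM : ∀ μ, B μ ≤ Mg μ) (p : Tor B × ι) : ∃ y ∈ boxWindow Mg B x₀ ×ˢ (Finset.univ : Finset ι), liftMap (boxChart Mg B x₀) ι y = p := by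
  obtain ⟨x, hx, hxt⟩ := surj_boxChart Mg B x₀ hBM p.1
  exact ⟨(x, p.2), Finset.mk_mem_product hx (Finset.mem_univ _), by simp only [liftMap, hxt]⟩

variable (L : ℕ) [NeZero L]

omit hB in
/-- `hW` in product form. [folklore] -/
theorem mem_product_fine_iff (y : Tor (fine L Mg) × ι) :
    y ∈ boxWindow (fine L Mg) (fine L B) (corner L Mg x₀) ×ˢ (Finset.univ : Finset ι) ↔ liftMap (blockOf L Mg) ι y ∈ boxWindow Mg B x₀ ×ˢ (Finset.univ : Finset ι) := by
  simp only [Finset.mem_product, Finset.mem_univ, and_true, liftMap]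
  exact mem_boxWindow_fine_iff L Mg B x₀ y.1

/-- `hcompat` in product form. [folklore] -/
theorem liftMap_boxChart_blockOf {y : Tor (fine L Mg) × ι} (hy : y ∈ boxWindow (fine L Mg) (fine L B) (corner L Mg x₀) ×ˢ (Finset.univ : Finset ι)) :
    liftMap (boxChart Mg B x₀) ι (liftMap (blockOf L Mg) ι y) = liftMap (blockOf L B) ι (liftMap (boxChart (fine L Mg) (fine L B) (corner L Mg x₀)) ι y) := by
  simp only [liftMap, Prod.mk.injEq, and_true]
  exact boxChart_blockOf L Mg B x₀ (Finset.mem_product.1 hy).1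

/-- dag-n15-w2 g3's `hcompat` (`∀ x ∈ W, E x ∈ W → e (E x) = E′ (e x)`) on the carriers with a vector index, for ANY packaging `E`, `E′` of the forward unit translation in direction `μ`
(e.g. `Equiv.prodCongr (torStep _ μ) (Equiv.refl ι)` coerced to a function). [cite: Balaban1984PropagatorsII, p.238 (identification □̃³ ↔ T_□: shape)] -/
theorem liftMap_boxChart_shift_compat (hBM : ∀ μ, B μ ≤ Mg μ) (μ : Fin d) {E : Tor Mg × ι → Tor Mg × ι} {E' : Tor B × ι → Tor B × ι}
    (hE : ∀ p, E p = (p.1 + unitVec Mg μ, p.2)) (hE' : ∀ q, E' q = (q.1 + unitVec B μ, q.2)) :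
    ∀ y ∈ boxWindow Mg B x₀ ×ˢ (Finset.univ : Finset ι), E y ∈ boxWindow Mg B x₀ ×ˢ (Finset.univ : Finset ι) →
      liftMap (boxChart Mg B x₀) ι (E y) = E' (liftMap (boxChart Mg B x₀) ι y) := by
  intro y hy hEy
  rw [hE] at hEy ⊢; rw [hE']; simp only [liftMap, Prod.mk.injEq, and_true]
  exact boxChart_add_unitVec Mg B x₀ hBM μ (Finset.mem_product.1 hy).1 (Finset.mem_product.1 hEy).1

/-- The same for the BACKWARD unit translation (`E = τ_μ⁻¹`). [cite: Balaban1984PropagatorsII, p.238 (identification □̃³ ↔ T_□: shape)] -/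
theorem liftMap_boxChart_shift_symm_compat (hBM : ∀ μ, B μ ≤ Mg μ) (μ : Fin d) {E : Tor Mg × ι → Tor Mg × ι} {E' : Tor B × ι → Tor B × ι}
    (hE : ∀ p, E p = (p.1 - unitVec Mg μ, p.2)) (hE' : ∀ q, E' q = (q.1 - unitVec B μ, q.2)) :
    ∀ y ∈ boxWindow Mg B x₀ ×ˢ (Finset.univ : Finset ι), E y ∈ boxWindow Mg B x₀ ×ˢ (Finset.univ : Finset ι) →
      liftMap (boxChart Mg B x₀) ι (E y) = E' (liftMap (boxChart Mg B x₀) ι y) := by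
  intro y hy hEy
  rw [hE] at hEy ⊢; rw [hE']; simp only [liftMap, Prod.mk.injEq, and_true]
  exact boxChart_sub_unitVec Mg B x₀ hBM μ (Finset.mem_product.1 hy).1 (Finset.mem_product.1 hEy).1

omit hB in
/-- `hblk` in product form. [folklore] -/
theorem liftBlk_boxChart {S : Type} (blkY : Tor Mg → S) {y : Tor Mg × ι} (hy : y ∈ boxWindow Mg B x₀ ×ˢ (Finset.univ : Finset ι)) :
    liftBlk (blkY ∘ boxEmbed Mg B x₀) ι (liftMap (boxChart Mg B x₀) ι y) = liftBlk blkY ι y := by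
  simp only [liftBlk]
  exact blk_boxChart Mg B x₀ blkY (Finset.mem_product.1 hy).1

/-- `hblkf` in product form. [folklore] -/
theorem liftBlk_boxChart_fine {S : Type} (blkY : Tor Mg → S) {y : Tor (fine L Mg) × ι} (hy : y ∈ boxWindow (fine L Mg) (fine L B) (corner L Mg x₀) ×ˢ (Finset.univ : Finset ι)) :
    liftBlk ((blkY ∘ boxEmbed Mg B x₀) ∘ blockOf L B) ι (liftMap (boxChart (fine L Mg) (fine L B) (corner L Mg x₀)) ι y) = liftBlk (blkY ∘ blockOf L Mg) ι y := by
  simpa only [liftBlk, Function.comp_apply] using blk_boxChart_fine L Mg B x₀ blkY (Finset.mem_product.1 hy).1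

end Product

/-! ### File 11's transplant theorems on King's tori, geometry discharged -/

section Transplant

variable {d : ℕ} (L : ℕ) [NeZero L] (Mg B : Fin d → ℕ) [hMg : ∀ μ, NeZero (Mg μ)] [hB : ∀ μ, NeZero (B μ)] (x₀ : Tor Mg) {geo : B6.Geometry}

omit [NeZero L] in
/-- ★★ **THE (2.133) SHAPE ON KING'S TORUS, ONE SPACING**: a cube-torus operator `T` on `Tor B` with block majorant `K ≥ 0` (cube blocks = the global blocks read through the chart), transplanted
through the box window of side `B ≤ M_g` at `x₀`, has the majorant `1_W(y)·1_W(y′)·K(y, y′)` on `Tor M_g` — file 11's `hasMaj_transplant` with `hinj`, `hblk` DISCHARGED.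
[cite: Balaban1984PropagatorsII, (2.133) p.247, p.238 (T_□: shapes)] -/
theorem hasMaj_transplant_box (blkY : Tor Mg → geo.Site) {T : Module.End ℝ (Tor B → ℝ)} {K : geo.Site → geo.Site → ℝ} (hK : ∀ a b, 0 ≤ K a b)
    (hT : HasMaj (BlockNorm.ofBlocks geo (blkY ∘ boxEmbed Mg B x₀)) (BlockNorm.ofBlocks geo (blkY ∘ boxEmbed Mg B x₀)) T K) :
    HasMaj (BlockNorm.ofBlocks geo blkY) (BlockNorm.ofBlocks geo blkY) (transplant (boxWindow Mg B x₀) (boxChart Mg B x₀) T)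
      (fun y y' => windowInd (boxWindow Mg B x₀) blkY y * windowInd (boxWindow Mg B x₀) blkY y' * K y y') :=
  hasMaj_transplant (boxWindow Mg B x₀) (boxChart Mg B x₀) blkY (blkY ∘ boxEmbed Mg B x₀) (injOn_boxChart Mg B x₀) (fun _ hx => blk_boxChart Mg B x₀ blkY hx) hK hT

/-- ★★ **TWO-GRID DEFECT LETTERS OF A CUBE-TORUS PAIR, READ ON KING'S TORI**: a pair `(T′, T)` on `(Tor (fine L B), Tor B)` with `𝔇(T′, T) ≤ K` between the cube block sizes has, after
transplanting through the box windows (sides `L·B`, `B`; corners `L·x₀`, `x₀`; `B ≤ M_g`), `𝔇 ≤ 1_{W_f}(y)·1_W(y′)·K(y, y′)` on `(Tor (fine L M_g), Tor M_g)` — file 11's `hasMaj_idef_transplant` with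
ALL SEVEN geometric hypotheses DISCHARGED. [cite: Balaban1984PropagatorsII, (2.133) p.247, p.238 (T_□: shapes); Balaban1985BackgroundPropagators, p.399 (localized propagators)] -/
theorem hasMaj_idef_transplant_box (hBM : ∀ μ, B μ ≤ Mg μ) (blkY : Tor Mg → geo.Site) {T : Module.End ℝ (Tor B → ℝ)} {T' : Module.End ℝ (Tor (fine L B) → ℝ)}
    {K : geo.Site → geo.Site → ℝ} (hK : ∀ a b, 0 ≤ K a b)
    (hD : HasMaj (BlockNorm.ofBlocks geo (blkY ∘ boxEmbed Mg B x₀)) (BlockNorm.ofBlocks geo ((blkY ∘ boxEmbed Mg B x₀) ∘ blockOf L B))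
      (idef (pull (blockOf L B)) (pull (blockOf L B)) T' T) K) :
    HasMaj (BlockNorm.ofBlocks geo blkY) (BlockNorm.ofBlocks geo (blkY ∘ blockOf L Mg))
      (idef (pull (blockOf L Mg)) (pull (blockOf L Mg)) (transplant (boxWindow (fine L Mg) (fine L B) (corner L Mg x₀)) (boxChart (fine L Mg) (fine L B) (corner L Mg x₀)) T')
        (transplant (boxWindow Mg B x₀) (boxChart Mg B x₀) T))
      (fun y y' => windowInd (boxWindow (fine L Mg) (fine L B) (corner L Mg x₀)) (blkY ∘ blockOf L Mg) y * windowInd (boxWindow Mg B x₀) blkY y' * K y y') :=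
  hasMaj_idef_transplant (boxWindow Mg B x₀) (boxChart Mg B x₀) (boxWindow (fine L Mg) (fine L B) (corner L Mg x₀)) (boxChart (fine L Mg) (fine L B) (corner L Mg x₀))
    (blockOf L Mg) (blockOf L B) blkY (blkY ∘ boxEmbed Mg B x₀) (blkY ∘ blockOf L Mg) ((blkY ∘ boxEmbed Mg B x₀) ∘ blockOf L B)
    (injOn_boxChart Mg B x₀) (injOn_boxChart (fine L Mg) (fine L B) (corner L Mg x₀)) (surj_boxChart (fine L Mg) (fine L B) (corner L Mg x₀) (fine_le_fine L Mg B hBM))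
    (mem_boxWindow_fine_iff L Mg B x₀) (fun _ hy => boxChart_blockOf L Mg B x₀ hy) (fun _ hx => blk_boxChart Mg B x₀ blkY hx) (fun _ hy => blk_boxChart_fine L Mg B x₀ blkY hy) hK hD

variable {ι J : Type} [Fintype ι] [DecidableEq ι] [Fintype J]

/-- ★★★ **THE CUBE INPUT OF THE GLUING ON KING'S TORI — GEOMETRY DISCHARGED.**  A pair-valued cube engine at two spacings on the cube tori with a vector index — `T` on `Tor B × ι`, `T′` on
`Tor (fine L B) × ι` (e.g. dag-n15-w3's file 10 `hasMaj_idef_curvDressed_kingTorus` at `M := B`, cube blocks `blkY ∘ boxEmbed`) — whose η-defect has the block majorant `K ≥ 0` (`key`): EVERY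
component `j`, transplanted through the box windows `W ×ˢ univ`, `W_f ×ˢ univ` (sides `B`, `L·B`; `B ≤ M_g`) by the charts `liftMap (boxChart …) ι`, has on the global tori `Tor M_g × ι`,
`Tor (fine L M_g) × ι` the two-grid defect majorant `1_{W_f}(y)·1_W(y′)·K(y, y′)` — file 11's `hasMaj_idef_transplant_pair_proj` with `hinj`, `hinjf`, `hsurjf`, `hW`, `hcompat`, `hblk`, `hblkf`
ALL DISCHARGED; displayed: `key` and `K ≥ 0` only. [cite: Balaban1984PropagatorsII, (2.133) p.247, (2.90)–(2.91) p.239, p.238 (shapes); Balaban1985BackgroundPropagators, p.399 (localized propagators)] -/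
theorem hasMaj_idef_transplant_pair_proj_box (hBM : ∀ μ, B μ ≤ Mg μ) (blkY : Tor Mg → geo.Site)
    {T : (Tor B × ι → ℝ) →ₗ[ℝ] ((Tor B × ι) × Option J → ℝ)} {T' : (Tor (fine L B) × ι → ℝ) →ₗ[ℝ] ((Tor (fine L B) × ι) × Option J → ℝ)}
    {K : geo.Site → geo.Site → ℝ} (hK : ∀ a b, 0 ≤ K a b)
    (key : HasMaj (BlockNorm.ofBlocks geo (liftBlk (blkY ∘ boxEmbed Mg B x₀) ι)) (BlockNorm.ofBlocks geo (BackgroundLayer.blkPair (liftBlk ((blkY ∘ boxEmbed Mg B x₀) ∘ blockOf L B) ι)))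
      (idef (pull (liftMap (blockOf L B) ι)) (pull (BackgroundLayer.liftPair (liftMap (blockOf L B) ι))) T' T) K) (j : Option J) :
    HasMaj (BlockNorm.ofBlocks geo (liftBlk blkY ι)) (BlockNorm.ofBlocks geo (liftBlk (blkY ∘ blockOf L Mg) ι))
      (idef (pull (liftMap (blockOf L Mg) ι)) (pull (liftMap (blockOf L Mg) ι))
        (transplant (boxWindow (fine L Mg) (fine L B) (corner L Mg x₀) ×ˢ (Finset.univ : Finset ι)) (liftMap (boxChart (fine L Mg) (fine L B) (corner L Mg x₀)) ι) (BackgroundLayer.projO j ∘ₗ T'))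
        (transplant (boxWindow Mg B x₀ ×ˢ (Finset.univ : Finset ι)) (liftMap (boxChart Mg B x₀) ι) (BackgroundLayer.projO j ∘ₗ T)))
      (fun y y' => windowInd (boxWindow (fine L Mg) (fine L B) (corner L Mg x₀) ×ˢ (Finset.univ : Finset ι)) (liftBlk (blkY ∘ blockOf L Mg) ι) y *
        windowInd (boxWindow Mg B x₀ ×ˢ (Finset.univ : Finset ι)) (liftBlk blkY ι) y' * K y y') :=
  hasMaj_idef_transplant_pair_proj (blkY ∘ boxEmbed Mg B x₀) (blockOf L B) (liftBlk blkY ι) (liftBlk (blkY ∘ blockOf L Mg) ι) (liftMap (blockOf L Mg) ι)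
    (boxWindow Mg B x₀ ×ˢ (Finset.univ : Finset ι)) (liftMap (boxChart Mg B x₀) ι)
    (boxWindow (fine L Mg) (fine L B) (corner L Mg x₀) ×ˢ (Finset.univ : Finset ι)) (liftMap (boxChart (fine L Mg) (fine L B) (corner L Mg x₀)) ι)
    (injOn_liftMap_boxChart Mg B x₀ ι) (injOn_liftMap_boxChart (fine L Mg) (fine L B) (corner L Mg x₀) ι)
    (surj_liftMap_boxChart (fine L Mg) (fine L B) (corner L Mg x₀) ι (fine_le_fine L Mg B hBM))
    (mem_product_fine_iff Mg B x₀ ι L) (fun _ hy => liftMap_boxChart_blockOf Mg B x₀ ι L hy)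
    (fun _ hy => liftBlk_boxChart Mg B x₀ ι blkY hy) (fun _ hy => liftBlk_boxChart_fine Mg B x₀ ι L blkY hy) hK key j

omit [NeZero L] in
/-- ★★ **THE CUBE INPUT OF THE GLUING ON KING'S TORUS, MAJORANTS (one spacing) — GEOMETRY DISCHARGED**: file 11's `hasMaj_transplant_pair_proj` with `hinj`, `hblk` discharged for the box
window ∕ chart. [cite: Balaban1984PropagatorsII, (2.133) p.247 (shape)] -/
theorem hasMaj_transplant_pair_proj_box (blkY : Tor Mg → geo.Site) {T : (Tor B × ι → ℝ) →ₗ[ℝ] ((Tor B × ι) × Option J → ℝ)} {K₀ : geo.Site → geo.Site → ℝ} (hK : ∀ a b, 0 ≤ K₀ a b)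
    (key₀ : HasMaj (BlockNorm.ofBlocks geo (liftBlk (blkY ∘ boxEmbed Mg B x₀) ι)) (BlockNorm.ofBlocks geo (BackgroundLayer.blkPair (liftBlk (blkY ∘ boxEmbed Mg B x₀) ι))) T K₀) (j : Option J) :
    HasMaj (BlockNorm.ofBlocks geo (liftBlk blkY ι)) (BlockNorm.ofBlocks geo (liftBlk blkY ι))
      (transplant (boxWindow Mg B x₀ ×ˢ (Finset.univ : Finset ι)) (liftMap (boxChart Mg B x₀) ι) (BackgroundLayer.projO j ∘ₗ T))
      (fun y y' => windowInd (boxWindow Mg B x₀ ×ˢ (Finset.univ : Finset ι)) (liftBlk blkY ι) y * windowInd (boxWindow Mg B x₀ ×ˢ (Finset.univ : Finset ι)) (liftBlk blkY ι) y' * K₀ y y') :=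
  hasMaj_transplant_pair_proj (blkY ∘ boxEmbed Mg B x₀) (liftBlk blkY ι) (boxWindow Mg B x₀ ×ˢ (Finset.univ : Finset ι)) (liftMap (boxChart Mg B x₀) ι)
    (injOn_liftMap_boxChart Mg B x₀ ι) (fun _ hy => liftBlk_boxChart Mg B x₀ ι blkY hy) hK key₀ j

end Transplant

end Summit.QuantumFields.YangMills.BalabanUVNodes.N15.TorusBoxCharts

end
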